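import Literature.MathematicalPhysics.QuantumFieldTheory.Balaban1983to89.B9Cor35GDirInputsAtOne

/-!
# `Balaban1983to89.B9Cor35GDirGStep` — [Balaban1985BackgroundPropagators] Theorem 3.4 p. 400 ∕ Corollary 3.5 p. 407, THE `G`-STEP (3.84)–(3.86)
# «Δ_a(U′U) = Δ_a(U) − V(A) = (I − V(A)G(U))Δ_a(U) … G(U′U) = G(U)(I − V(A)G(U))⁻¹ = Σ_{n=0}^∞ G(U)(V(A)G(U))ⁿ» AT THE DIRICHLET BOND LETTERS OF
# THE CUBE SEQUENCE (p. 409 l. 3–5 «G_□(U)», p. 394 Dirichlet conventions), GENERIC IN THE `U`-FAMILY `T : U ↦ Δ_loc(U) − DP_□(U)D*`: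
# `IsUnit (padΔ(Ṽ))`, both resolvent identities of the padded inverse, THE COMPRESSED RESOLVENT IDENTITY of the interior letter
# `G_□(Ṽ) = G_□(1) + G_□(Ṽ)·(V·G_□(1))`, and the transfer of every LEFT (3.42)-entry with the interior shapes — the bond twin of r05's
# `B9Cor35GCubeInputsAtOne.gStep_cube`, seat dag-n06-c g33, FILE 3 (road (B5))

statement-level skeleton of published theorems with citation tags; proofs where landed; nothing here is a claim about the Yang–Mills mass gap

CITATION HEADER (lean-in-tree rule).  B9 = T. Bałaban, *Propagators for lattice gauge theories in a background field*, Commun. Math. Phys. **99** (1985)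
389–434 [Balaban1985BackgroundPropagators] (held `paper:balaban1985-cmp99-background-propagators`; journal page = PDF page + 388): Thm 3.4 p. 400 «There
exists a positive constant a₁ such that the operators G′(U), (Q′(U)G′²(U)Q′*(U))⁻¹, R(U), G(U) extend to configurations U′U for α₁ ≦ a₁ … The extended
operators satisfy all the inequalities of Theorems 3.1–3.3 correspondingly»; p. 407 (3.84)–(3.86) (quoted in the title) and l. 26–35 (Cor. 3.5: «with U = 1,
these theorems were proved in [4]»); p. 409 l. 3–5 (the cube operators `G_□(U)` «satisfy all the inequalities of Theorems 3.1–3.3»); p. 394 l. 24–33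
(«Δ′_a↾Ω₀ = Ω₀Δ′_aΩ₀ … Its inverse is denoted by G′»); (3.26)–(3.27) p. 395; (3.42) p. 397.  [4] = [Balaban1984PropagatorsII] Lemma 2.1 (2.61) p. 234, (2.66)
p. 234, (2.51) p. 232.  Rows B9.Thm3.4 × B9.Cor3.5 × B9.Thm3.3 (cells only; no row head changes).

WHY THIS FILE (director-ym №606 road (B5); dag-lead g46 WORDS 814/822; this seat's LOCATED-33/34 and FILES 1–2).  FILE 2 (`B9Cor35GDirInputsAtOne`) supplies,
at `U = 1`, the padded Dirichlet bond pair `Δa = conj b(padΔ(1))`, `G = conj b((padΔ(1))⁻¹)` with `Δa·G = 1 = G·Δa`, the interior letter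
`GiK = conj b(𝟙_B(padΔ(1))⁻¹𝟙_B)` and its three (3.42)-type rows (conditional by name on [4] Prop. 2.6 for `G(Ω)`).  The next step of Cor. 3.5 is the
`G`-STEP (3.84)–(3.86): extension to the (3.37)-small field `Ṽ` by the Neumann series, r06's LETTER-FREE `B9Ineq385VG.exists_gExt_of_385` ∕
`gExt_leftEntry_of_386` (from the two inverse laws, a (3.85)-majorant `V·G ≺ θe^{−ρd}`, [4] (2.61) at `(ρ, α′)` and `θc₁(α′) < 1`).  r05 instantiated it
at the whole-torus cube letter (`gStep_cube`); THIS FILE instantiates it at the DIRICHLET letters, for ANY `U`-family `T` of flat bond operators padded to a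
bond set `B` — so that both the cube-levelled letter (C) `T U = Δ_{loc,□}(U) − DP_□(U)D*` (print's `G_□`, LOCATED-34) and the member-levelled letter (M) of
the current heads (`dirPadY 𝟙_B (T U) = padDeltaLocBY … U` by `rfl`) plug in.  One point is specific to the Dirichlet letter and settled here: the padded
inverse carries IDENTITY exterior rows (FILE 2 `GdK_eq_GiK_add`), which are NOT of the `(Lⁿη)²` shape in continuum units; but the remainder
`V = padΔ(1) − padΔ(Ṽ) = 𝟙_B(T(1) − T(Ṽ))𝟙_B` kills them (`V·(1 − 𝟙_B)♯ = 0`), so (3.85) is a statement about the INTERIOR letter only, and compressing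
the resolvent identity by `𝟙_B` gives the fixed point `G_□(Ṽ) = G_□(1) + G_□(Ṽ)·(V·G_□(1))` for the INTERIOR letters alone, to which [4] (2.66) applies
with the clean interior shapes.

WHAT IS PROVED (1 `def` with body — `VdK`; theorems; 0 sorry; 0 new named facts; standard axioms):
* §1 `VdK b i T B V` (the realified (3.84) remainder), `dirPadY_sub_dirPadY`, `VdK_eq`, ★`DadK_sub_VdK` (`Δa − V = conj b(padΔ(Ṽ))`), `DadK_mul_GdK_of_isUnit`,
  `projK`, `projK_mul_projK`, `projK_mul_VdK`, `VdK_mul_projK`, `liftOpY_one_sub_indDiagY`, ★`VdK_mul_exterior_eq_zero`, ★`GiK_eq_proj_GdK_proj`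
  (`GiK = 𝟙♯·G·𝟙♯`), ★`h385_padded_of_interior` (`V·G ≺ K` from `V·GiK ≺ K`);
* §2 ★★★`gStep_dirB` — for ANY background `V` (meant `Ṽ_□`): from FILE 2's `hT1`/`hKB` at `U = 1`, `h385 : V·GiK(1) ≺ θe^{−ρd}` over `toB6 (geoCK i □) Rr H`,
  [4] (2.61) at `(ρ, α′)` and `θc₁(α′) < 1`: (i) `IsUnit (padΔ(Ṽ))` (so `Ring.inverse` is the genuine inverse and def-Y's `dirInvY 𝟙_B (T Ṽ)` the genuine
  Dirichlet inverse); (ii) both resolvent identities of (3.86) for the padded letter and THE COMPRESSED IDENTITY `GiK(Ṽ) = GiK(1) + GiK(Ṽ)·(V·GiK(1))`;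
  (iii) every left entry `X·GiK(1) ≺ B₀P(y)e^{−ρd}` (`P ≥ 0`; `X = 1, conj b(∇_ν), conj b(Δ)` by FILE 2) transfers to
  `X·GiK(Ṽ) ≺ B₀c₁(α′)(1 − θc₁(α′))⁻¹P(y)e^{−(1−α′)ρd}`; corollary ★★`gStep_dirB_rows` (the three FILE-2-shaped rows at `Ṽ`).

HONEST SCOPE / NOT CLAIMED.  Resolvent bookkeeping over r06's majorant calculus; the (3.85)-majorant `h385` for the Dirichlet letters (print: the Laplacian
piece (3.69)–(3.73), the projection piece (3.74)–(3.77), the averaging piece (3.80)–(3.83), at the cube-levelled letters) is a HYPOTHESIS here — the next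
files' target (r05's `B9Cor35GAtCubeLettersFirstOrder` chain re-keyed); [4] (2.61) (`h261`, p33's `exists_h261_geoCK` supplies it) and the smallness are
displayed; the `U = 1` sockets `hT1`, `hKB` are FILE 2's.  RIGHT entries, Hölder ∕ `L²` ∕ (3.47) members, Cor. 3.6 covariance: NOT here.  Nothing on `d = 4`,
the continuum, reflection positivity or the mass gap; NOT a node discharge; count-neutral; no row head changes.

RELATED IN THE TREE, NOT DUPLICATED: r05's `B9Cor35GCubeInputsAtOne.gStep_cube` (whole-torus letter; same r06 engine), r06's `B9Ineq385VG` (the engine, used by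
name), my UNIT 2 `B9Cor35GpDirAtCubeLetters` (SITE Dirichlet letter, Sect. B engine), FILE 2 `B9Cor35GDirInputsAtOne` (the letters), def-Y's file H
`OpsYCubeDirInverseBond` (`padDeltaLocBY`/`GDirBY`: the (M) instances by `rfl`).
-/

noncomputable section

namespace Literature.MathematicalPhysics.QuantumFieldTheory.Balaban1983to89.B9Cor35GDirGStep

open Literature.MathematicalPhysics.QuantumFieldTheory.Balaban1983to89
open Literature.MathematicalPhysics.QuantumFieldTheory.Balaban1983to89.B6RandomWalk (HasMajorant hasMajorant_mono)
open Literature.MathematicalPhysics.QuantumFieldTheory.Balaban1983to89.B9Thm34Ext (toB6)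
open Literature.MathematicalPhysics.QuantumFieldTheory.Balaban1983to89.B9Eq352DivFormLetters (conj)
open Literature.MathematicalPhysics.QuantumFieldTheory.Balaban1983to89.B6KLevelCensusIndexV1 (KIdx)
open Literature.MathematicalPhysics.QuantumFieldTheory.Balaban1983to89.B6Cover236MultiLevelBlocks (cubes)
open Literature.MathematicalPhysics.QuantumFieldTheory.Balaban1983to89.B9CubeLettersBondOpsL0 (BlkCubeY)
open Literature.MathematicalPhysics.QuantumFieldTheory.Balaban1983to89.B9CubeGeometryInputs (geoCK geoCK_dist_axioms)
open Literature.MathematicalPhysics.QuantumFieldTheory.Balaban1983to89.B9Cor35GpCubeInputsAtOne (conj_one')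
open Literature.MathematicalPhysics.QuantumFieldTheory.Balaban1983to89.B9Cor35GCubeInputsAtOne (blkBK)
open Literature.MathematicalPhysics.QuantumFieldTheory.Balaban1983to89.B9Cor36GpCubeEntriesAtV (conj_add')
open Literature.MathematicalPhysics.QuantumFieldTheory.Balaban1983to89.B9Cor35AtOneInverseLetters (liftOpY_one)
open Literature.MathematicalPhysics.QuantumFieldTheory.Balaban1983to89.B9Eq359CubeKernelsAtOne (isUnit_of_conj_laws)
open Literature.MathematicalPhysics.QuantumFieldTheory.Balaban1983to89.B9Cor35GDirInputsAtOne (DadK GdK GiK DadK_mul_GdK GdK_eq_GiK_add)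
open Literature.MathematicalPhysics.QuantumFieldTheory.Balaban1983to89.Node00 (FBondY CfgY toKT liftOpY liftOpY_eq_liftMatY liftMatY_sub)
open Literature.MathematicalPhysics.QuantumFieldTheory.Balaban1983to89.Node00.OpsYLocalInverse (dirPadY dirInvY)
open Literature.MathematicalPhysics.QuantumFieldTheory.Balaban1983to89.Node00.OpsYCubeDirInverse (indDiagY)
open Literature.MathematicalPhysics.QuantumFieldTheory.Balaban1983to89.Node00.OpsYCubeDirInverseBond (indProjY indProjY_mul_indProjY indProjY_eq_liftOpY)
open scoped Matrix

variable {d ℓ : ℕ} {hd : 1 ≤ d + 1} {hL : Odd (ℓ + 1) ∧ 1 < ℓ + 1} {b₀ b₁ : ℝ}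

/-! ## §1  The (3.84) remainder at the Dirichlet bond letters, and the algebra that keeps the exterior rows out -/

section Letters

variable {𝔸 : Type} [NormedRing 𝔸] [NormedAlgebra ℂ 𝔸] [CompleteSpace 𝔸]
variable {ι : Type} [Fintype ι] (b : Module.Basis ι ℝ 𝔸)
variable (i : KIdx d ℓ hd hL b₀ b₁)

/-- `padΔ(X) − padΔ(Y) = 𝟙(X − Y)𝟙` (the exterior identity blocks cancel). [cite: Balaban1985BackgroundPropagators, (3.84) p.407, p.394, bookkeeping] -/
theorem dirPadY_sub_dirPadY {A : Type} [Ring A] (P X Y : A) : dirPadY P X - dirPadY P Y = P * (X - Y) * P := by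
  simp only [dirPadY, mul_sub, sub_mul]
  abel

variable (T : CfgY 𝔸 i → ((FBondY i → 𝔸) →ₗ[ℂ] (FBondY i → 𝔸))) (B : Finset (FBondY i)) (V : CfgY 𝔸 i)

/-- **the realified (3.84) remainder `V := padΔ(1) − padΔ(Ṽ)`** of a `U`-family of flat bond operators padded to `B` («Δ_a(U′U) = Δ_a(U) − V(A)» at `U = 1`
for the Dirichlet cube letter). [cite: Balaban1985BackgroundPropagators, (3.82)–(3.84) p.407, p.409 l.3–5] -/
def VdK : Module.End ℝ (FBondY i × ι → ℝ) :=
  conj b ((dirPadY (indProjY B) (T (fun _ _ => 1)) - dirPadY (indProjY B) (T V)).restrictScalars ℝ)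

/-- `V = conj b((𝟙_B(T(1) − T(Ṽ))𝟙_B)♯)`. [cite: Balaban1985BackgroundPropagators, (3.84) p.407, bookkeeping] -/
theorem VdK_eq : VdK b i T B V = conj b ((indProjY B * (T (fun _ _ => 1) - T V) * indProjY B).restrictScalars ℝ) := by
  rw [VdK, dirPadY_sub_dirPadY]

/-- ★ **(3.84) BOOKKEEPING**: `Δa − V = conj b(padΔ(Ṽ))` — the operator the `G`-step inverts. [cite: Balaban1985BackgroundPropagators, (3.84) p.407 («Δ_a(U′U) = Δ_a(U) − V(A)»)] -/
theorem DadK_sub_VdK : DadK b i (T (fun _ _ => 1)) B - VdK b i T B V = DadK b i (T V) B := by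
  have e : ((dirPadY (indProjY B) (T (fun _ _ => 1)) - dirPadY (indProjY B) (T V)).restrictScalars ℝ) =
      (dirPadY (indProjY B) (T (fun _ _ => 1))).restrictScalars ℝ - (dirPadY (indProjY B) (T V)).restrictScalars ℝ :=
    LinearMap.ext fun _ => rfl
  rw [DadK, DadK, VdK, ← B9Eq352DivFormLetters.conj_sub, e, sub_sub_cancel]

variable {T B V}

omit [CompleteSpace 𝔸] in
/-- once `padΔ(Ṽ)` is a unit, `conj b((padΔ(Ṽ))⁻¹)` inverts `conj b(padΔ(Ṽ))` on both sides. [cite: Balaban1985BackgroundPropagators, (3.27) p.395, bookkeeping] -/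
theorem DadK_mul_GdK_of_isUnit {T₁ : (FBondY i → 𝔸) →ₗ[ℂ] (FBondY i → 𝔸)} (hU : IsUnit (dirPadY (indProjY B) T₁)) :
    DadK b i T₁ B * GdK b i T₁ B = 1 ∧ GdK b i T₁ B * DadK b i T₁ B = 1 := by
  constructor
  · rw [DadK, GdK, ← B9Eq352DivFormLetters.conj_mul, Module.End.mul_eq_comp, ← LinearMap.restrictScalars_comp, ← Module.End.mul_eq_comp,
      Ring.mul_inverse_cancel _ hU]
    exact conj_one' b
  · rw [DadK, GdK, ← B9Eq352DivFormLetters.conj_mul, Module.End.mul_eq_comp, ← LinearMap.restrictScalars_comp, ← Module.End.mul_eq_comp,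
      Ring.inverse_mul_cancel _ hU]
    exact conj_one' b

variable (B)

/-- the realified bond projection `𝟙_B♯`. [cite: Balaban1985BackgroundPropagators, p.394 («Ω₀ denotes a characteristic function»), bookkeeping] -/
abbrev projK : Module.End ℝ (FBondY i × ι → ℝ) := conj b ((indProjY (𝔸 := 𝔸) B).restrictScalars ℝ)

omit [CompleteSpace 𝔸] in
/-- `𝟙♯·𝟙♯ = 𝟙♯`. [cite: Balaban1985BackgroundPropagators, p.394, bookkeeping] -/
theorem projK_mul_projK : projK b i B * projK b i B = projK (𝔸 := 𝔸) b i B := by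
  rw [projK, ← B9Eq352DivFormLetters.conj_mul, Module.End.mul_eq_comp, ← LinearMap.restrictScalars_comp, ← Module.End.mul_eq_comp,
    indProjY_mul_indProjY]

omit [CompleteSpace 𝔸] in
/-- `(1 − 𝟙_B)♯ = 1 − 𝟙♯` on the `𝔸`-valued bond functions. [cite: Balaban1985BackgroundPropagators, p.394, bookkeeping] -/
theorem liftOpY_one_sub_indDiagY : liftOpY 𝔸 (1 - indDiagY B) = 1 - indProjY (𝔸 := 𝔸) B := by
  rw [liftOpY_eq_liftMatY, liftMatY_sub, ← liftOpY_eq_liftMatY, ← liftOpY_eq_liftMatY, liftOpY_one, indProjY_eq_liftOpY]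
  rfl

omit [CompleteSpace 𝔸] in
/-- ★ **THE INTERIOR LETTER IS THE COMPRESSION OF THE PADDED ONE**: `GiK = 𝟙♯·G·𝟙♯` (def-Y's `dirInvY 𝟙 T = 𝟙(padΔ)⁻¹𝟙`).
[cite: Balaban1985BackgroundPropagators, p.394 («Δ′_a↾Ω₀ = Ω₀Δ′_aΩ₀ … Its inverse»), (3.27) p.395, p.409 l.3–5] -/
theorem GiK_eq_proj_GdK_proj (T₁ : (FBondY i → 𝔸) →ₗ[ℂ] (FBondY i → 𝔸)) : GiK b i T₁ B = projK b i B * GdK b i T₁ B * projK b i B := by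
  rw [GiK, GdK, projK, dirInvY, ← B9Eq352DivFormLetters.conj_mul, ← B9Eq352DivFormLetters.conj_mul]
  rfl

variable {B}

/-- `𝟙♯·V = V`. [cite: Balaban1985BackgroundPropagators, (3.84) p.407, p.394, bookkeeping] -/
theorem projK_mul_VdK : projK b i B * VdK b i T B V = VdK b i T B V := by
  rw [VdK_eq, projK, ← B9Eq352DivFormLetters.conj_mul, Module.End.mul_eq_comp, ← LinearMap.restrictScalars_comp, ← Module.End.mul_eq_comp,
    ← mul_assoc, ← mul_assoc, indProjY_mul_indProjY]

/-- `V·𝟙♯ = V`. [cite: Balaban1985BackgroundPropagators, (3.84) p.407, p.394, bookkeeping] -/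
theorem VdK_mul_projK : VdK b i T B V * projK b i B = VdK b i T B V := by
  rw [VdK_eq, projK, ← B9Eq352DivFormLetters.conj_mul, Module.End.mul_eq_comp, ← LinearMap.restrictScalars_comp, ← Module.End.mul_eq_comp,
    mul_assoc, indProjY_mul_indProjY]

/-- ★ **THE REMAINDER KILLS THE EXTERIOR ROWS**: `V·(1 − 𝟙_B)♯ = 0` (`V = 𝟙V𝟙`, `𝟙(1 − 𝟙) = 0`). [cite: Balaban1985BackgroundPropagators, (3.84) p.407, p.394 («Ω₀Δ′_aΩ₀»), bookkeeping] -/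
theorem VdK_mul_exterior_eq_zero : VdK b i T B V * conj b ((liftOpY 𝔸 (1 - indDiagY B)).restrictScalars ℝ) = 0 := by
  rw [VdK_eq, ← B9Eq352DivFormLetters.conj_mul, Module.End.mul_eq_comp, ← LinearMap.restrictScalars_comp, ← Module.End.mul_eq_comp,
    liftOpY_one_sub_indDiagY, mul_sub, mul_one, mul_assoc _ (indProjY B) (indProjY B), indProjY_mul_indProjY, sub_self]
  simp only [B9Eq352DivFormLetters.conj, map_zero, LinearMap.restrictScalars_zero]

/-- ★ **(3.85) IS A STATEMENT ABOUT THE INTERIOR LETTER**: `V·G = V·GiK` at `U = 1` (the exterior identity rows of the padded inverse drop out), hence any majorant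
of `V·GiK` is one of `V·G`. [cite: Balaban1985BackgroundPropagators, (3.85) p.407, p.394, bookkeeping] -/
theorem VdK_mul_GdK_eq {M KB : Matrix (FBondY i) (FBondY i) ℝ} (hT1 : T (fun _ _ => 1) = liftOpY 𝔸 M)
    (hKB : M.submatrix (fun v : ↥B => (v : FBondY i)) (fun v : ↥B => (v : FBondY i)) *
      KB.submatrix (fun v : ↥B => (v : FBondY i)) (fun v : ↥B => (v : FBondY i)) = 1) :
    VdK b i T B V * GdK b i (T (fun _ _ => 1)) B = VdK b i T B V * GiK b i (T (fun _ _ => 1)) B := by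
  rw [GdK_eq_GiK_add b i hT1 hKB, mul_add, VdK_mul_exterior_eq_zero, add_zero]

/-- corollary: the (3.85)-majorant passes from the interior letter to the padded letter. [cite: Balaban1985BackgroundPropagators, (3.85) p.407; Balaban1984PropagatorsII, (2.51) p.232] -/
theorem h385_padded_of_interior (q : ↥(cubes (toKT i).D.toDomains)) {M KB : Matrix (FBondY i) (FBondY i) ℝ} (hT1 : T (fun _ _ => 1) = liftOpY 𝔸 M)
    (hKB : M.submatrix (fun v : ↥B => (v : FBondY i)) (fun v : ↥B => (v : FBondY i)) *
      KB.submatrix (fun v : ↥B => (v : FBondY i)) (fun v : ↥B => (v : FBondY i)) = 1) (Rr : ℝ) (H : Prop) {K : BlkCubeY i q → BlkCubeY i q → ℝ}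
    (h385 : HasMajorant (g := toB6 (geoCK i q) Rr H) (blkBK i q) (VdK b i T B V * GiK b i (T (fun _ _ => 1)) B) K) :
    HasMajorant (g := toB6 (geoCK i q) Rr H) (blkBK i q) (VdK b i T B V * GdK b i (T (fun _ _ => 1)) B) K := by
  rwa [VdK_mul_GdK_eq b i hT1 hKB]

end Letters

/-! ## §2  ★★★ The `G`-step at the Dirichlet bond letters: unit, padded and compressed resolvent identities, transfer of the left entries -/

section GStep

variable {𝔸 : Type} [NormedRing 𝔸] [NormedAlgebra ℂ 𝔸] [CompleteSpace 𝔸]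
variable {ι : Type} [Fintype ι] (b : Module.Basis ι ℝ 𝔸)
variable (i : KIdx d ℓ hd hL b₀ b₁) (q : ↥(cubes (toKT i).D.toDomains))
variable {T : CfgY 𝔸 i → ((FBondY i → 𝔸) →ₗ[ℂ] (FBondY i → 𝔸))} {B : Finset (FBondY i)} {M KB : Matrix (FBondY i) (FBondY i) ℝ}

/-- ★★★ **THE `G`-STEP OF THEOREM 3.4 ∕ COR. 3.5 AT THE DIRICHLET BOND LETTERS, GENERIC IN THE `U`-FAMILY** («Δ_a(U′U) = Δ_a(U) − V(A) = (I − V(A)G(U))Δ_a(U) …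
V(A)G(U) is a small operator … G(U′U) = G(U)(I − V(A)G(U))⁻¹», p. 407, at `U = 1` for the cube sequence's Dirichlet letter `G_□`, Cor. 3.5): IF at `U = 1` the
padded operator reads `T(1) = M♯` with a real `K_B` inverting the compression of `M` to `B` (FILE 2's sockets), the realified remainder times the INTERIOR
letter has the (3.85)-majorant `V·GiK(1) ≺ θe^{−ρd}` over `toB6 (geoCK i □)` (`h385`; NOT proved here), [4] Lemma 2.1 holds at `(ρ, α′)` and `θc₁(α′) < 1`,
THEN: (i) `padΔ(Ṽ) = 𝟙_B T(Ṽ) 𝟙_B + (1 − 𝟙_B)` is a unit; (ii) `G(Ṽ) = conj b((padΔ(Ṽ))⁻¹)` satisfies both resolvent identities of (3.86) AND the interior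
letter satisfies the COMPRESSED identity `GiK(Ṽ) = GiK(1) + GiK(Ṽ)·(V·GiK(1))`; (iii) every LEFT entry `X·GiK(1) ≺ B₀P(y)e^{−ρd}` (`P ≧ 0`; `X = 1`,
`conj b(∇_ν)`, `conj b(Δ)` by FILE 2) transfers to `X·GiK(Ṽ) ≺ B₀c₁(α′)(1 − θc₁(α′))⁻¹P(y)e^{−(1−α′)ρd}` — r06's abstract `exists_gExt_of_385` ∕
`gExt_leftEntry_of_386` at these letters, uniqueness of the two-sided inverse, and §1's exterior-row algebra.
[cite: Balaban1985BackgroundPropagators, Thm 3.4 p.400, Cor. 3.5 p.407, (3.84)–(3.86) p.407, Thm 3.3 p.399, (3.42) p.397, p.409 l.3–5, p.394; Balaban1984PropagatorsII, Lemma 2.1 p.234, (2.66) p.234, (2.51) p.232] -/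
theorem gStep_dirB (hT1 : T (fun _ _ => 1) = liftOpY 𝔸 M)
    (hKB : M.submatrix (fun v : ↥B => (v : FBondY i)) (fun v : ↥B => (v : FBondY i)) *
      KB.submatrix (fun v : ↥B => (v : FBondY i)) (fun v : ↥B => (v : FBondY i)) = 1)
    (Rr : ℝ) (H : Prop) (dB : ℕ) {ρ α' θ : ℝ} (hθ : 0 ≤ θ) (hρ : 0 ≤ ρ) (hα' : α' ≤ 1) (hα'ρ : 0 ≤ (1 - α') * ρ)
    (h261 : B6RandomWalk.Ineq261 dB (toB6 (geoCK i q) Rr H) ρ α') (hsmall : θ * B6.c1 dB ρ α' < 1) (V : CfgY 𝔸 i)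
    (h385 : HasMajorant (g := toB6 (geoCK i q) Rr H) (blkBK i q) (VdK b i T B V * GiK b i (T (fun _ _ => 1)) B)
      (fun a a' => θ * Real.exp (-(ρ * (geoCK i q).dist a a')))) :
    IsUnit (dirPadY (indProjY B) (T V)) ∧
    (GdK b i (T V) B = GdK b i (T (fun _ _ => 1)) B + GdK b i (T (fun _ _ => 1)) B * VdK b i T B V * GdK b i (T V) B ∧
      GdK b i (T V) B = GdK b i (T (fun _ _ => 1)) B + GdK b i (T V) B * (VdK b i T B V * GdK b i (T (fun _ _ => 1)) B) ∧
      GiK b i (T V) B = GiK b i (T (fun _ _ => 1)) B + GiK b i (T V) B * (VdK b i T B V * GiK b i (T (fun _ _ => 1)) B)) ∧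
    ∀ (X : Module.End ℝ (FBondY i × ι → ℝ)) (B₀ : ℝ) (P : BlkCubeY i q → ℝ), 0 ≤ B₀ → (∀ y, 0 ≤ P y) →
      HasMajorant (g := toB6 (geoCK i q) Rr H) (blkBK i q) (X * GiK b i (T (fun _ _ => 1)) B)
        (fun a a' => B₀ * P a * Real.exp (-(ρ * (geoCK i q).dist a a'))) →
      HasMajorant (g := toB6 (geoCK i q) Rr H) (blkBK i q) (X * GiK b i (T V) B)
        (fun a a' => B₀ * B6.c1 dB ρ α' * (1 - θ * B6.c1 dB ρ α')⁻¹ * P a * Real.exp (-((1 - α') * ρ * (geoCK i q).dist a a'))) := by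
  classical
  obtain ⟨hdnn, htri, hrefl, -⟩ := geoCK_dist_axioms i q Rr H
  obtain ⟨hΔG, hGΔ⟩ := DadK_mul_GdK b i (T₁ := T (fun _ _ => 1)) hT1 hKB
  have h385p := h385_padded_of_interior b i q hT1 hKB Rr H h385
  -- (3.86): the Neumann inverse of `Δa − V` exists (r06's abstract step) for the PADDED pair
  obtain ⟨GExt, h386a, h386b, hinvL, hinvR⟩ := B9Ineq385VG.exists_gExt_of_385 (R := Rr) (H := H) (blkBK i q) dB ρ α' θ hθ hα'ρ hdnn h261 hsmall
    (DadK b i (T (fun _ _ => 1)) B) (GdK b i (T (fun _ _ => 1)) B) (VdK b i T B V) hΔG hGΔ h385p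
  rw [DadK_sub_VdK] at hinvL hinvR
  -- (i) the unit
  have hU : IsUnit (dirPadY (indProjY B) (T V)) := by
    refine isUnit_of_conj_laws b (dirPadY (indProjY B) (T V)) one_ne_zero GExt ?_ ?_
    · rw [one_smul]; exact hinvL
    · rw [one_smul]; exact hinvR
  -- uniqueness of the two-sided inverse: `GExt = conj b((padΔ(Ṽ))⁻¹)`
  obtain ⟨h1, -⟩ := DadK_mul_GdK_of_isUnit b i hU
  have hEq : GExt = GdK b i (T V) B := by
    calc GExt = GExt * (DadK b i (T V) B * GdK b i (T V) B) := by rw [h1, mul_one]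
      _ = GdK b i (T V) B := by rw [← mul_assoc, hinvR, one_mul]
  subst hEq
  -- the compressed identity: multiply (3.86) (right form) by `𝟙♯` on both sides; `V = 𝟙♯V𝟙♯`
  have hPVP : VdK b i T B V = projK b i B * VdK b i T B V * projK b i B := by rw [projK_mul_VdK, VdK_mul_projK]
  have hcomp : GiK b i (T V) B = GiK b i (T (fun _ _ => 1)) B + GiK b i (T V) B * (VdK b i T B V * GiK b i (T (fun _ _ => 1)) B) := by
    rw [GiK_eq_proj_GdK_proj b i B (T V), GiK_eq_proj_GdK_proj b i B (T (fun _ _ => 1))]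
    conv_lhs => rw [h386b]
    rw [mul_add, add_mul]
    congr 1
    conv_lhs => rw [hPVP]
    simp only [mul_assoc]
  refine ⟨hU, ⟨h386a, h386b, hcomp⟩, fun X B₀ P hB₀ hP hX => ?_⟩
  exact B9Ineq385VG.gExt_leftEntry_of_386 (R := Rr) (H := H) (blkBK i q) dB ρ α' θ B₀ P hB₀ hP hθ hρ hα' hα'ρ htri hrefl hdnn h261 hsmall hX h385
    hcomp

/-- ★★ **THE THREE (3.42)-TYPE ROWS AT THE SMALL FIELD**: from FILE 2's three `U = 1` rows of the interior letter (`GiK(1) ≺ A(Lⁿη)²e^{−ρd}`,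
`conj b(∇_ν)·GiK(1) ≺ A(Lⁿη)e^{−ρd}`, `conj b(Δ)·GiK(1) ≺ Ae^{−ρd}`, `A ≧ 0`) and the hypotheses of `gStep_dirB`: the same three rows for `GiK(Ṽ)` with
`A′ = Ac₁(α′)(1 − θc₁(α′))⁻¹` at the rate `(1−α′)ρ` («The extended operators satisfy all the inequalities of Theorems 3.1–3.3», left entries).
[cite: Balaban1985BackgroundPropagators, Thm 3.4 p.400, Cor. 3.5 p.407, (3.86) p.407, (3.42) p.397, p.409 l.3–5; Balaban1984PropagatorsII, (2.66) p.234] -/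
theorem gStep_dirB_rows (hT1 : T (fun _ _ => 1) = liftOpY 𝔸 M)
    (hKB : M.submatrix (fun v : ↥B => (v : FBondY i)) (fun v : ↥B => (v : FBondY i)) *
      KB.submatrix (fun v : ↥B => (v : FBondY i)) (fun v : ↥B => (v : FBondY i)) = 1)
    (Rr : ℝ) (H : Prop) (dB : ℕ) {ρ α' θ : ℝ} (hθ : 0 ≤ θ) (hρ : 0 ≤ ρ) (hα' : α' ≤ 1) (hα'ρ : 0 ≤ (1 - α') * ρ)
    (h261 : B6RandomWalk.Ineq261 dB (toB6 (geoCK i q) Rr H) ρ α') (hsmall : θ * B6.c1 dB ρ α' < 1) (V : CfgY 𝔸 i)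
    (h385 : HasMajorant (g := toB6 (geoCK i q) Rr H) (blkBK i q) (VdK b i T B V * GiK b i (T (fun _ _ => 1)) B)
      (fun a a' => θ * Real.exp (-(ρ * (geoCK i q).dist a a'))))
    {A : ℝ} (hA : 0 ≤ A)
    (hG : HasMajorant (g := toB6 (geoCK i q) Rr H) (blkBK i q) (GiK b i (T (fun _ _ => 1)) B)
      (fun a a' => A * (geoCK i q).len a ^ 2 * Real.exp (-(ρ * (geoCK i q).dist a a'))))
    (DX : Fin (d + 1) → Module.End ℝ (FBondY i × ι → ℝ))
    (hDG : ∀ ν, HasMajorant (g := toB6 (geoCK i q) Rr H) (blkBK i q) (DX ν * GiK b i (T (fun _ _ => 1)) B)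
      (fun a a' => A * (geoCK i q).len a * Real.exp (-(ρ * (geoCK i q).dist a a'))))
    (LX : Module.End ℝ (FBondY i × ι → ℝ))
    (hLapG : HasMajorant (g := toB6 (geoCK i q) Rr H) (blkBK i q) (LX * GiK b i (T (fun _ _ => 1)) B)
      (fun a a' => A * Real.exp (-(ρ * (geoCK i q).dist a a')))) :
    HasMajorant (g := toB6 (geoCK i q) Rr H) (blkBK i q) (GiK b i (T V) B)
        (fun a a' => A * B6.c1 dB ρ α' * (1 - θ * B6.c1 dB ρ α')⁻¹ * (geoCK i q).len a ^ 2 *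
          Real.exp (-((1 - α') * ρ * (geoCK i q).dist a a'))) ∧
    (∀ ν, HasMajorant (g := toB6 (geoCK i q) Rr H) (blkBK i q) (DX ν * GiK b i (T V) B)
        (fun a a' => A * B6.c1 dB ρ α' * (1 - θ * B6.c1 dB ρ α')⁻¹ * (geoCK i q).len a *
          Real.exp (-((1 - α') * ρ * (geoCK i q).dist a a')))) ∧
    HasMajorant (g := toB6 (geoCK i q) Rr H) (blkBK i q) (LX * GiK b i (T V) B)
        (fun a a' => A * B6.c1 dB ρ α' * (1 - θ * B6.c1 dB ρ α')⁻¹ * 1 * Real.exp (-((1 - α') * ρ * (geoCK i q).dist a a'))) := by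
  obtain ⟨-, -, htr⟩ := gStep_dirB b i q hT1 hKB Rr H dB hθ hρ hα' hα'ρ h261 hsmall V h385
  refine ⟨?_, fun ν => ?_, ?_⟩
  · have h := htr 1 A (fun y => (geoCK i q).len y ^ 2) hA (fun y => sq_nonneg _) (by simpa only [one_mul] using hG)
    simpa only [one_mul] using h
  · exact htr (DX ν) A (fun y => (geoCK i q).len y) hA (fun y => (B9CubeGeometryInputs.geoCK_len_pos i q y).le) (hDG ν)
  · exact htr LX A (fun _ => 1) hA (fun _ => zero_le_one) (by simpa only [mul_one] using hLapG)

end GStep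

end Literature.MathematicalPhysics.QuantumFieldTheory.Balaban1983to89.B9Cor35GDirGStep
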